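import Mathlib
import HarnessLib

/-!
# Route `PhantomRMYoshida`, crux `StableYoshidaCongruence` (stmt-Langlands-13640), line
# `serre-dual-ribet-square`: Stub 2b `stub_steinbergEigenvalueRatio`

The linear-algebra TAIL of Ribet's level-raising congruence (Grothendieck monodromy at `ℓ ≠ p`).
Input (from the sibling monodromy stub): `F, N ∈ M₂(ℚ̄_p)` with `N ≠ 0`, `N² = 0` and
`F N = q • (N F)`.  Output: if `charpoly F` is the image of an integral `Q ∈ 𝒪[X]`
(`𝒪 = 𝒪_{ℚ̄_p}` the valuation ring) and `Q` reduces to `(X - a)(X - b)`, then `a = q b ∨ b = q a`.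

Proof (Mathlib only, no named facts, no definitions).
* Linear algebra (`charpoly_eq_of_mul_eq_smul_mul`, any field): pick `w` with `e := N w ≠ 0`;
  `N e = N² w = 0`, so `(e, w)` is a basis; writing `F w = α e + β w`, the relation gives
  `F e = F N w = q N F w = q β e`, so the matrix of `F` in `(e, w)` is `!![q β, α; 0, β]` and
  `charpoly F = (X - q β)(X - β)` (`LinearMap.charpoly_toMatrix`, `Matrix.charpoly_fin_two`).
* Integrality (`mem_integer_of_isRoot_map`): `Q` is monic (its image is) and `β` is a root of
  `Q.map (𝒪 ↪ ℚ̄_p)`, hence integral over `𝒪`, hence in `𝒪`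
  (`Valuation.Integers.mem_of_integral`: valuation rings are integrally closed); so
  `Q = (X - q β')(X - β')` in `𝒪[X]` (`Polynomial.map_injective`).
* Reduction (`ratio_of_quadratic_eq`, any domain): `(X - a)(X - b) = (X - q c)(X - c)` forces,
  evaluating at `a`, `b`, `c`, `q c`, that `a = q b ∨ b = q a`.
-/

-- `Summit.Langlands.Langlands.…` (summit = sub-problem name, D-0017 layout) trips `dupNamespace` on every decl.
set_option linter.dupNamespace false

noncomputable section

open Polynomial
open scoped Matrix

namespace Summit.Langlands.Langlands.Cruxes.StableYoshidaCongruence.SerreDualRibetSquare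

/-- **Shape of a `2 × 2` matrix normalising a non-zero square-zero matrix.**  Over a field, if
`N ≠ 0`, `N ^ 2 = 0` and `F * N = c • (N * F)`, then `F.charpoly = (X - C (c * β)) * (X - C β)` for
some `β`: in a basis `(N w, w)` with `N w ≠ 0` the matrix of `F` is upper triangular with diagonal
`(c β, β)`. [folklore] -/
theorem charpoly_eq_of_mul_eq_smul_mul {K : Type*} [Field K] (c : K)
    (F N : Matrix (Fin 2) (Fin 2) K) (hN0 : N ≠ 0) (hN2 : N ^ 2 = 0)
    (hFN : F * N = c • (N * F)) :
    ∃ β : K, F.charpoly = (X - C (c * β)) * (X - C β) := by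
  classical
  -- a vector not killed by `N`
  obtain ⟨w, hw⟩ : ∃ w : Fin 2 → K, N *ᵥ w ≠ 0 := by
    by_contra h
    push Not at h
    exact hN0 (Matrix.ext_of_mulVec_single fun i => by rw [h, Matrix.zero_mulVec])
  set e : Fin 2 → K := N *ᵥ w with he_def
  have hNN : ∀ v, N *ᵥ (N *ᵥ v) = 0 := fun v => by
    rw [Matrix.mulVec_mulVec, ← sq, hN2, Matrix.zero_mulVec]
  have hFNv : ∀ v, F *ᵥ (N *ᵥ v) = c • (N *ᵥ (F *ᵥ v)) := fun v => by
    rw [Matrix.mulVec_mulVec, hFN, Matrix.smul_mulVec, ← Matrix.mulVec_mulVec]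
  have hNe : N *ᵥ e = 0 := hNN w
  -- `(e, w)` is linearly independent, hence a basis
  have hli : LinearIndependent K ![e, w] := by
    rw [LinearIndependent.pair_iff]
    intro s t hst
    have ht : t = 0 := by
      have h1 := congrArg (N *ᵥ ·) hst
      simp only [Matrix.mulVec_add, Matrix.mulVec_smul, hNe, smul_zero, zero_add,
        Matrix.mulVec_zero] at h1
      exact (smul_eq_zero.mp h1).resolve_right hw
    subst ht
    rw [zero_smul, add_zero] at hst
    exact ⟨(smul_eq_zero.mp hst).resolve_right hw, rfl⟩
  let b : Module.Basis (Fin 2) K (Fin 2 → K) := basisOfPiSpaceOfLinearIndependent hli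
  have hb0 : b 0 = e := by simp [b]
  have hb1 : b 1 = w := by simp [b]
  set α : K := b.repr (F *ᵥ w) 0 with hα
  set β : K := b.repr (F *ᵥ w) 1 with hβ
  have hFw : F *ᵥ w = α • e + β • w := by
    have h := b.sum_repr (F *ᵥ w)
    rw [Fin.sum_univ_two, hb0, hb1] at h
    exact h.symm
  have hFe : F *ᵥ b 0 = (c * β) • b 0 := by
    rw [hb0, he_def, hFNv, hFw, Matrix.mulVec_add, Matrix.mulVec_smul, Matrix.mulVec_smul, hNe,
      smul_zero, zero_add, smul_smul]
  refine ⟨β, ?_⟩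
  -- entries of the matrix of `F` in the basis `b`
  set M : Matrix (Fin 2) (Fin 2) K := LinearMap.toMatrix b b (Matrix.toLin' F) with hM
  have h00 : M 0 0 = c * β := by
    rw [hM, LinearMap.toMatrix_apply, Matrix.toLin'_apply, hFe, map_smul, b.repr_self]
    simp
  have h10 : M 1 0 = 0 := by
    rw [hM, LinearMap.toMatrix_apply, Matrix.toLin'_apply, hFe, map_smul, b.repr_self]
    simp
  have h01 : M 0 1 = α := by
    rw [hM, LinearMap.toMatrix_apply, Matrix.toLin'_apply, hb1]
  have h11 : M 1 1 = β := by
    rw [hM, LinearMap.toMatrix_apply, Matrix.toLin'_apply, hb1]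
  rw [← Matrix.charpoly_toLin', ← LinearMap.charpoly_toMatrix _ b, ← hM, Matrix.charpoly_fin_two,
    Matrix.trace_fin_two, Matrix.det_fin_two, h00, h01, h10, h11, mul_zero, sub_zero]
  simp only [map_add, map_mul]
  ring

/-- **Roots of integral monic polynomials are integral** (valuation rings are integrally closed,
`Valuation.Integers.mem_of_integral`): if `Q ∈ 𝒪[K][X]` is monic and `x ∈ K` is a root of its image
in `K[X]`, then `x ∈ 𝒪[K]`. [folklore] -/
theorem mem_integer_of_isRoot_map {K : Type*} [Field K] {Γ₀ : Type*}
    [LinearOrderedCommGroupWithZero Γ₀] [Valued K Γ₀] {Q : Polynomial (Valued.integer K)}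
    (hQ : Q.Monic) {x : K} (hx : (Q.map (Valued.integer K).subtype).IsRoot x) :
    x ∈ Valued.integer K :=
  (Valuation.integer.integers (Valued.v : Valuation K Γ₀)).mem_of_integral
    ⟨Q, hQ, by rwa [Polynomial.eval₂_eq_eval_map]⟩

/-- **Unique factorisation of a split monic quadratic over a domain, in ratio form**: if
`(X - a)(X - b) = (X - q c)(X - c)` then `a = q b ∨ b = q a` (evaluate at `a`, `b`, `c`, `q c`).
[folklore] -/
theorem ratio_of_quadratic_eq {k : Type*} [CommRing k] [IsDomain k] {a b c q : k}
    (h : (X - C a) * (X - C b) = (X - C (q * c)) * (X - C c)) : a = q * b ∨ b = q * a := by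
  have key : ∀ x, (x - a) * (x - b) = (x - q * c) * (x - c) := fun x => by
    have hx := congrArg (Polynomial.eval x) h
    simp only [eval_mul, eval_sub, eval_X, eval_C] at hx
    exact hx
  have ha := key a
  have hb := key b
  simp only [sub_self, zero_mul, mul_zero, zero_eq_mul, sub_eq_zero] at ha hb
  rcases ha with ha | ha <;> rcases hb with hb | hb
  · -- `a = q c`, `b = q c`: then `c ∈ {a, b}`
    have hc := key c
    simp only [sub_self, mul_zero, mul_eq_zero, sub_eq_zero] at hc
    rcases hc with hc | hc
    · exact Or.inr (by rw [hb, hc])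
    · exact Or.inl (by rw [ha, hc])
  · exact Or.inl (by rw [ha, hb])
  · exact Or.inr (by rw [hb, ha])
  · -- `a = c`, `b = c`: then `q c ∈ {a, b}`
    have hqc := key (q * c)
    simp only [sub_self, zero_mul, mul_eq_zero, sub_eq_zero] at hqc
    rcases hqc with hqc | hqc
    · exact Or.inl (by rw [hb]; exact hqc.symm)
    · exact Or.inr (by rw [ha]; exact hqc.symm)

/-- **Stub 2b (`stub_steinbergEigenvalueRatio`, TAIL; Mathlib-level linear algebra + valuation-ring
integrality + reduction).**  Let `F, N ∈ M₂(ℚ̄_p)` with `N ≠ 0`, `N² = 0` and `F N = q • (N F)`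
(`q : ℕ`).  Then `F` preserves the line `L = im N = ker N`, acts on it by `x` and on `ℚ̄_p²/L` by `y`
with `x = q y`, so `charpoly F = (X - y)(X - q y)`.  If `charpoly F = Q.map (𝒪 ↪ ℚ̄_p)` for
`Q ∈ 𝒪[X]` (`𝒪 = 𝒪_{ℚ̄_p}` the valuation ring, integrally closed, so the roots `y, q y` of the monic
`Q` lie in `𝒪`) and `Q.map red = (X - a)(X - b)` in `k[X]`, then `{a, b} = {ȳ, q ȳ}` (unique
factorisation of a monic quadratic over a field), i.e. `a = q b ∨ b = q a` with `q` read in `k`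
through `Nat.cast` (`map_natCast`).
[folklore; cite: DiamondTaylor1994, §1 (shape of Steinberg lifts); SerreLocalFields1979, Ch. I §4
(valuation rings are integrally closed)] -/
theorem stub_steinbergEigenvalueRatio :
    ∀ (p : ℕ) [Fact p.Prime] (k : Type) [Field k]
      (red : Valued.integer (PadicAlgCl p) →+* k) (q : ℕ)
      (F N : Matrix (Fin 2) (Fin 2) (PadicAlgCl p))
      (Q : Polynomial (Valued.integer (PadicAlgCl p))) (a b : k),
      N ≠ 0 → N ^ 2 = 0 →
      F * N = (q : PadicAlgCl p) • (N * F) →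
      F.charpoly = Q.map (Valued.integer (PadicAlgCl p)).subtype →
      Q.map red = (X - C a) * (X - C b) →
      (a = (q : k) * b ∨ b = (q : k) * a) := by
  intro p _ k _ red q F N Q a b hN0 hN2 hFN hchar hred
  obtain ⟨β, hβ⟩ := charpoly_eq_of_mul_eq_smul_mul (q : PadicAlgCl p) F N hN0 hN2 hFN
  -- `Q.map (𝒪 ↪ ℚ̄_p) = (X - q β)(X - β)`
  have hQ : Q.map (Valued.integer (PadicAlgCl p)).subtype =
      (X - C ((q : PadicAlgCl p) * β)) * (X - C β) := hchar.symm.trans hβ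
  have hmonic : Q.Monic :=
    Polynomial.monic_of_injective (Subring.subtype_injective _)
      (by rw [hQ]; exact (monic_X_sub_C _).mul (monic_X_sub_C _))
  -- `β` is integral
  obtain ⟨β', rfl⟩ : ∃ β' : Valued.integer (PadicAlgCl p), (β' : PadicAlgCl p) = β :=
    ⟨⟨β, mem_integer_of_isRoot_map hmonic (by rw [hQ, Polynomial.IsRoot.def]; simp)⟩, rfl⟩
  -- hence `Q = (X - q β')(X - β')` already in `𝒪[X]`
  have hQ' : Q = (X - C ((q : Valued.integer (PadicAlgCl p)) * β')) * (X - C β') := by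
    refine Polynomial.map_injective _ (Subring.subtype_injective _) ?_
    rw [hQ]
    simp [Polynomial.map_mul, Polynomial.map_sub]
  -- reduce through `red` and compare with `(X - a)(X - b)`
  rw [hQ'] at hred
  simp only [Polynomial.map_mul, Polynomial.map_sub, Polynomial.map_X, Polynomial.map_C, map_mul red,
    map_natCast red] at hred
  exact ratio_of_quadratic_eq hred.symm

end Summit.Langlands.Langlands.Cruxes.StableYoshidaCongruence.SerreDualRibetSquare

end
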